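import Mathlib
import Literature.AlgebraicGeometry.Resolution.WeightedResolutionDatum
import Literature.AlgebraicGeometry.Resolution.CobordantBlowupGlobal
import Literature.AlgebraicGeometry.Resolution.MarkedIdealsLemmas
import Summits.ResolutionOfSingularities.ResolutionOfSingularities.Theorems.WeightedInvariantDefs
import HarnessLib

/-!
# The graded atlas on the cobordant blow-up: lifting lemmas (crux `DatumToEmbedded`, line `Sketch`)

Support lemmas for the lead's stub `stub_qs_atlas` of the line `Sketch` of the crux
`Theses.WeightedInvariant.DatumToEmbedded` (stmt-ResolutionOfSingularities-0572): the ASSEMBLY of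
the graded atlas of rank `j + 1` (structure `GradedAtlas`, `Theorems/WeightedInvariantDefs.lean`)
on the strict transform `X' ⊆ B₊` over the blow-up `V' = Bl_K V` of the quotient, from the ambient
charts (`AmbientChart`) and the principal charts downstairs.

Here: the algebra of a graded atlas `𝒜 : GradedAtlas j f i q` of rank `j` that the assembly
uses on every chart `a` — with `A = Γ(Y, W a)` graded by `𝒜.piece a`, `R = Γ(X, X ∩ W a)`,
`C = Γ(V, U a)`, the homogeneous pieces `Jₙ(W a)` of the centre and the downstairs centre
`K = (J_Dg|_X) pushed to V` (Mathlib `Scheme.IdealSheafData.map`):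

* `homogeneous_unit_inv_mem`, `zpow_unit_mem` — in a ring graded by an additive group the inverse
  of a homogeneous unit is homogeneous of the opposite degree, so integer powers of a homogeneous
  unit are homogeneous;
* `mem_map_ideal_iff` — `c ∈ K(U a)` iff `q♯ c ∈ J_Dg(W a) · R`;
* `exists_degreeZero_lift` — every `c ∈ K(U a)` is `q♯ c = i♯ β` for some `β ∈ J_Dg(W a)` of
  degree `0` (lift along the surjection `i♯`, then take the degree-`0` component: `J_Dg(W a)` and
  the ideal of `X` are homogeneous);
* `exists_lift_pow`, `exists_preimage_pow` — `q♯(K(U a)^l) = i♯(J_{Dg l}(W a) ∩ A₀)` in both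
  directions, given the Veronese generation (A2) of `stub_qs_degree`.

All proofs are glue on Mathlib and the tree; no definitions, no named facts.
-/

noncomputable section

open CategoryTheory AlgebraicGeometry TopologicalSpace DirectSum
open Literature.AlgebraicGeometry.Resolution

set_option linter.dupNamespace false -- mandated namespace `…Theorems.DatumToEmbedded.<Topic>`

namespace Summit.ResolutionOfSingularities.ResolutionOfSingularities.Theorems.DatumToEmbedded.Atlas

universe u

/-! ## Homogeneous units in a graded ring -/

section GradedUnits

variable {ι A σ : Type*} [DecidableEq ι] [AddCommGroup ι] [CommRing A] [SetLike σ A]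
  [AddSubgroupClass σ A] (𝒜 : ι → σ) [GradedRing 𝒜]

/-- **The inverse of a homogeneous unit is homogeneous of the opposite degree**: if `u ∈ 𝒜 d`
and `u * v = 1` then `v ∈ 𝒜 (-d)` (compare the degree-`0` components of `u * v = 1`:
`u * v_{-d} = 1`, so `v = v * (u * v_{-d}) = v_{-d} * (v * u) = v_{-d}`). [folklore] -/
theorem homogeneous_unit_inv_mem {d : ι} {u v : A} (hu : u ∈ 𝒜 d) (huv : u * v = 1) :
    v ∈ 𝒜 (-d) := by
  classical
  -- the degree `-d` component of `v`
  set w : A := (decompose 𝒜 v (-d) : A) with hw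
  have hwmem : w ∈ 𝒜 (-d) := (decompose 𝒜 v (-d)).2
  -- `u * w` is the degree-`0` component of `u * v = 1`, i.e. `1`
  have huw : u * w = 1 := by
    have h1 : (decompose 𝒜 (u * v) (d + -d) : A) = 1 := by
      rw [add_neg_cancel, huv, decompose_of_mem_same 𝒜 SetLike.GradedOne.one_mem]
    have h2 : (decompose 𝒜 (u * v) (d + -d) : A) = u * w :=
      coe_decompose_mul_add_of_left_mem 𝒜 (b := v) hu
    rw [← h2, h1]
  -- hence `v = w`
  have : v = w := by
    calc v = v * (u * w) := by rw [huw, mul_one]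
      _ = w * (u * v) := by ring
      _ = w := by rw [huv, mul_one]
  rw [this]
  exact hwmem

/-- Integer powers of a homogeneous unit are homogeneous: if `u ∈ 𝒜 d` is a unit then
`u ^ n ∈ 𝒜 (n • d)` for every `n : ℤ` (computed in the group of units). [folklore] -/
theorem zpow_unit_mem {d : ι} {u : Aˣ} (hu : (u : A) ∈ 𝒜 d) (n : ℤ) :
    ((u ^ n : Aˣ) : A) ∈ 𝒜 (n • d) := by
  have hinv : ((u⁻¹ : Aˣ) : A) ∈ 𝒜 (-d) := homogeneous_unit_inv_mem 𝒜 hu u.mul_inv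
  cases n with
  | ofNat n =>
    rw [Int.ofNat_eq_natCast, zpow_natCast, Units.val_pow_eq_pow_val, natCast_zsmul]
    exact SetLike.pow_mem_graded n hu
  | negSucc n =>
    rw [zpow_negSucc, ← inv_pow, Units.val_pow_eq_pow_val, negSucc_zsmul, ← smul_neg]
    exact SetLike.pow_mem_graded (n + 1) hinv

end GradedUnits

/-! ## Degree-zero components in the ambient chart ring -/

section DegreeZero

variable {M A : Type*} [DecidableEq M] [AddCommGroup M] [CommRing A]
  (𝒜 : M → AddSubgroup A) [GradedRing 𝒜]

/-- In a graded ring, the degree-`0` component of a member of a homogeneous ideal lies in the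
ideal. [folklore] -/
theorem decompose_zero_mem_of_isHomogeneous {I : Ideal A} (hI : I.IsHomogeneous 𝒜) {x : A}
    (hx : x ∈ I) : (decompose 𝒜 x 0 : A) ∈ I :=
  (hI.mem_iff.mp hx) 0

/-- If `x - s` lies in a homogeneous ideal `I` and `s` has degree `0`, then `x₀ - s ∈ I` for the
degree-`0` component `x₀` of `x`. [folklore] -/
theorem decompose_zero_sub_mem {I : Ideal A} (hI : I.IsHomogeneous 𝒜) {x s : A} (hs : s ∈ 𝒜 0)
    (hxs : x - s ∈ I) : (decompose 𝒜 x 0 : A) - s ∈ I := by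
  have h := decompose_zero_mem_of_isHomogeneous 𝒜 hI hxs
  rwa [decompose_sub, DirectSum.sub_apply, AddSubgroupClass.coe_sub,
    decompose_of_mem_same 𝒜 hs] at h

end DegreeZero

/-! ## The chart algebra of a graded atlas -/

section Chart

variable {k : Type} [Field k] {Y X V : Scheme.{0}} {f : Y ⟶ Spec (.of k)} {i : X ⟶ Y}
  [IsClosedImmersion i] {q : X ⟶ V} [QuasiCompact q] {j : ℕ} (𝒜 : GradedAtlas j f i q)
  (J : ℕ → Y.IdealSheafData)

omit [QuasiCompact q] in
/-- The affine open `X ∩ W a` of `X` under the chart `a`. [folklore] -/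
theorem isAffineOpen_preimage_W (a : 𝒜.ι) : IsAffineOpen (i ⁻¹ᵁ (𝒜.W a : Y.Opens)) :=
  (𝒜.W a).2.preimage i

/-- **Membership in the downstairs centre.** For the push-forward `K = (J_D|_X)·q` of the
restricted piece `J_D|_X = (J D).comap i` (Mathlib `Scheme.IdealSheafData.map`) and a section
`c` of `V` over the chart `U a`: `c ∈ K(U a)` iff `q♯ c` lies in the extension of `J_D(W a)` to
`Γ(X, X ∩ W a)` along `i♯`. [folklore] -/
theorem mem_map_ideal_iff (D : ℕ) (a : 𝒜.ι) (c : Γ(V, 𝒜.U a)) :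
    c ∈ (((J D).comap i).map q).ideal (𝒜.U a) ↔
      q.appLE (𝒜.U a) (i ⁻¹ᵁ (𝒜.W a)) (𝒜.preimage_eq a).le c ∈
        ((J D).ideal (𝒜.W a)).map (i.app (𝒜.W a)).hom := by
  have hWaff : IsAffineOpen (i ⁻¹ᵁ (𝒜.W a : Y.Opens)) := isAffineOpen_preimage_W 𝒜 a
  have hUaff : IsAffineOpen (q ⁻¹ᵁ (𝒜.U a : V.Opens)) := by
    rw [← 𝒜.preimage_eq a]; exact hWaff
  rw [Scheme.IdealSheafData.ideal_map _ q (𝒜.U a) hUaff, Ideal.mem_comap]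
  -- the pull-back ideal of `J D` on the affine `X ∩ W a = q⁻¹ U a` is the extension of `J D (W a)`
  have hcomap : (((J D).comap i).ideal ⟨i ⁻¹ᵁ (𝒜.W a), hWaff⟩) =
      ((J D).ideal (𝒜.W a)).map (i.app (𝒜.W a)).hom := by
    rw [ideal_comap_of_le i (J D) (𝒜.W a) ⟨i ⁻¹ᵁ (𝒜.W a), hWaff⟩ le_rfl,
      Scheme.Hom.appLE_eq_app]
  -- transport between the two presentations `q⁻¹ U a` and `i⁻¹ W a` of the same open
  have key : ∀ {O₁ O₂ : X.Opens} (h₁ : IsAffineOpen O₁) (h₂ : IsAffineOpen O₂) (e : O₂ = O₁)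
      (x : Γ(X, O₁)), x ∈ ((J D).comap i).ideal ⟨O₁, h₁⟩ ↔
        X.presheaf.map (homOfLE e.le).op x ∈ ((J D).comap i).ideal ⟨O₂, h₂⟩ := by
    intro O₁ O₂ h₁ h₂ e x
    subst e
    have hx : X.presheaf.map (homOfLE (le_refl O₂)).op x = x := by
      have : homOfLE (le_refl O₂) = 𝟙 _ := rfl
      rw [this, op_id, X.presheaf.map_id]
      rfl
    simp only [hx]
  rw [key hUaff hWaff (𝒜.preimage_eq a) (q.app (𝒜.U a) c), hcomap]
  rfl

/-- **Degree-zero lifts of the downstairs centre.** Every `c ∈ K(U a)` (notation of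
`mem_map_ideal_iff`) satisfies `q♯ c = i♯ β` for some `β ∈ J_D(W a)` of degree `0`, provided
`J_D(W a)` is homogeneous for the chart grading: lift `q♯ c` along the surjection `i♯` to some
`β₀ ∈ J_D(W a)`, lift it also to a degree-`0` section `s` (`𝒜.exists_lift`), and take `β` = the
degree-`0` component of `β₀`; `β₀ - s` lies in the (homogeneous) ideal of `X`, so `β - s` does
too. [folklore] -/
theorem exists_degreeZero_lift (D : ℕ) (a : 𝒜.ι)
    (hJ : letI := 𝒜.gradedRing a; ((J D).ideal (𝒜.W a)).IsHomogeneous (𝒜.piece a))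
    {c : Γ(V, 𝒜.U a)} (hc : c ∈ (((J D).comap i).map q).ideal (𝒜.U a)) :
    ∃ β : Γ(Y, 𝒜.W a), β ∈ (J D).ideal (𝒜.W a) ∧ β ∈ 𝒜.piece a 0 ∧
      i.app (𝒜.W a) β = q.appLE (𝒜.U a) (i ⁻¹ᵁ (𝒜.W a)) (𝒜.preimage_eq a).le c := by
  letI := 𝒜.gradedRing a
  rw [mem_map_ideal_iff 𝒜 J D a c] at hc
  obtain ⟨β₀, hβ₀, hβ₀c⟩ := (Ideal.mem_map_iff_of_surjective (i.app (𝒜.W a)).hom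
    (i.app_surjective _ (𝒜.W a).2)).mp hc
  obtain ⟨s, hs0, hsc⟩ := 𝒜.exists_lift a c
  -- `β₀ - s` lies in the ideal of `X` on the chart
  have hker : β₀ - s ∈ i.ker.ideal (𝒜.W a) := by
    rw [Scheme.Hom.ker_apply, RingHom.mem_ker, map_sub, sub_eq_zero]
    exact hβ₀c.trans hsc
  refine ⟨(decompose (𝒜.piece a) β₀ 0 : Γ(Y, 𝒜.W a)), ?_, (decompose (𝒜.piece a) β₀ 0).2, ?_⟩
  · exact decompose_zero_mem_of_isHomogeneous (𝒜.piece a) hJ hβ₀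
  · have h := decompose_zero_sub_mem (𝒜.piece a) (𝒜.isHomogeneous_ker a) hs0 hker
    rw [Scheme.Hom.ker_apply, RingHom.mem_ker, map_sub, sub_eq_zero] at h
    exact h.trans hsc.symm

/-- **Lifting powers of the downstairs centre** (notation of `mem_map_ideal_iff`, with `J 0 = ⊤`,
`J` multiplicative and `J_D(W a)` homogeneous): every `c ∈ K(U a)^l` satisfies `q♯ c = i♯ x` for
some `x ∈ J_{D l}(W a)` of degree `0` (induction on `l`: products of degree-`0` lifts).
[folklore] -/
theorem exists_lift_pow (D : ℕ) (a : 𝒜.ι) (hJ0 : J 0 = ⊤)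
    (hJmul : ∀ m n : ℕ, J m * J n ≤ J (m + n))
    (hJ : letI := 𝒜.gradedRing a; ((J D).ideal (𝒜.W a)).IsHomogeneous (𝒜.piece a))
    (l : ℕ) {c : Γ(V, 𝒜.U a)} (hc : c ∈ (((J D).comap i).map q).ideal (𝒜.U a) ^ l) :
    ∃ x : Γ(Y, 𝒜.W a), x ∈ (J (D * l)).ideal (𝒜.W a) ∧ x ∈ 𝒜.piece a 0 ∧
      i.app (𝒜.W a) x = q.appLE (𝒜.U a) (i ⁻¹ᵁ (𝒜.W a)) (𝒜.preimage_eq a).le c := by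
  letI := 𝒜.gradedRing a
  induction hc using Submodule.pow_induction_on_left' with
  | algebraMap r =>
    -- `l = 0`: any section, `J 0 = ⊤`
    obtain ⟨s, hs0, hsc⟩ := 𝒜.exists_lift a r
    refine ⟨s, ?_, hs0, ?_⟩
    · rw [mul_zero, hJ0, Scheme.IdealSheafData.ideal_top]
      exact Submodule.mem_top
    · rw [← hsc]
      rfl
  | add x y n hx hy ihx ihy =>
    obtain ⟨x₁, hx₁J, hx₁0, hx₁⟩ := ihx
    obtain ⟨y₁, hy₁J, hy₁0, hy₁⟩ := ihy
    exact ⟨x₁ + y₁, Ideal.add_mem _ hx₁J hy₁J, AddSubgroup.add_mem _ hx₁0 hy₁0,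
      by rw [map_add, map_add, hx₁, hy₁]⟩
  | mem_mul m hm n x _ ihx =>
    obtain ⟨x₁, hx₁J, hx₁0, hx₁⟩ := ihx
    obtain ⟨β, hβJ, hβ0, hβ⟩ := exists_degreeZero_lift 𝒜 J D a hJ hm
    refine ⟨β * x₁, ?_, ?_, ?_⟩
    · have hle : (J D).ideal (𝒜.W a) * (J (D * n)).ideal (𝒜.W a) ≤
          (J (D * (n + 1))).ideal (𝒜.W a) := by
        have h := hJmul D (D * n)
        rw [Scheme.IdealSheafData.le_def] at h
        have h' := h (𝒜.W a)
        rw [Scheme.IdealSheafData.ideal_mul, Pi.mul_apply] at h'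
        rw [show D * (n + 1) = D + D * n by ring]
        exact h'
      exact hle (Ideal.mul_mem_mul hβJ hx₁J)
    · simpa using SetLike.mul_mem_graded hβ0 hx₁0
    · rw [map_mul, map_mul, hβ, hx₁]

/-- **Descending degree-zero sections of the Veronese pieces** (notation of `mem_map_ideal_iff`):
granted the Veronese generation (A2) of `stub_qs_degree` on the chart `a` — every degree-`0`
member of `J_{D(l+1)}(W a)` is, modulo the ideal of `X`, in the additive closure of the products
`u v`, `u ∈ J_D(W a)`, `v ∈ J_{D l}(W a)` of degree `0` — every `x ∈ J_{D l}(W a)` of degree `0`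
satisfies `i♯ x = q♯ c` for some `c ∈ K(U a)^l`. [folklore] -/
theorem exists_preimage_pow (D : ℕ) (a : 𝒜.ι)
    (hA2 : ∀ (l : ℕ) (x : Γ(Y, 𝒜.W a)), x ∈ (J (D * (l + 1))).ideal (𝒜.W a) →
      x ∈ 𝒜.piece a 0 → ∃ y ∈ AddSubgroup.closure
        {z : Γ(Y, 𝒜.W a) | ∃ u v : Γ(Y, 𝒜.W a),
          u ∈ (J D).ideal (𝒜.W a) ∧ u ∈ 𝒜.piece a 0 ∧
          v ∈ (J (D * l)).ideal (𝒜.W a) ∧ v ∈ 𝒜.piece a 0 ∧ z = u * v},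
        x - y ∈ i.ker.ideal (𝒜.W a))
    (l : ℕ) {x : Γ(Y, 𝒜.W a)} (hxJ : x ∈ (J (D * l)).ideal (𝒜.W a)) (hx0 : x ∈ 𝒜.piece a 0) :
    ∃ c : Γ(V, 𝒜.U a), c ∈ (((J D).comap i).map q).ideal (𝒜.U a) ^ l ∧
      q.appLE (𝒜.U a) (i ⁻¹ᵁ (𝒜.W a)) (𝒜.preimage_eq a).le c = i.app (𝒜.W a) x := by
  letI := 𝒜.gradedRing a
  -- a degree-zero section descends to `V`, and it lies in `K` as soon as it is in `J_D · R`
  have hdesc : ∀ {x : Γ(Y, 𝒜.W a)}, x ∈ 𝒜.piece a 0 → ∃ c : Γ(V, 𝒜.U a),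
      q.appLE (𝒜.U a) (i ⁻¹ᵁ (𝒜.W a)) (𝒜.preimage_eq a).le c = i.app (𝒜.W a) x :=
    fun {x} hx0 => 𝒜.exists_preimage a x hx0
  induction l generalizing x with
  | zero =>
    obtain ⟨c, hc⟩ := hdesc hx0
    exact ⟨c, by rw [pow_zero, Ideal.one_eq_top]; exact Submodule.mem_top, hc⟩
  | succ l ih =>
    obtain ⟨y, hy, hxy⟩ := hA2 l x hxJ hx0
    -- every element of the closure descends into `K^{l+1}`
    have hcl : ∀ y ∈ AddSubgroup.closure
        {z : Γ(Y, 𝒜.W a) | ∃ u v : Γ(Y, 𝒜.W a),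
          u ∈ (J D).ideal (𝒜.W a) ∧ u ∈ 𝒜.piece a 0 ∧
          v ∈ (J (D * l)).ideal (𝒜.W a) ∧ v ∈ 𝒜.piece a 0 ∧ z = u * v},
        ∃ c : Γ(V, 𝒜.U a), c ∈ (((J D).comap i).map q).ideal (𝒜.U a) ^ (l + 1) ∧
          q.appLE (𝒜.U a) (i ⁻¹ᵁ (𝒜.W a)) (𝒜.preimage_eq a).le c = i.app (𝒜.W a) y := by
      intro y hy
      induction hy using AddSubgroup.closure_induction with
      | mem z hz =>
        obtain ⟨u, v, huJ, hu0, hvJ, hv0, rfl⟩ := hz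
        obtain ⟨cu, hcu⟩ := hdesc hu0
        obtain ⟨cv, hcvK, hcv⟩ := ih hvJ hv0
        have hcuK : cu ∈ (((J D).comap i).map q).ideal (𝒜.U a) := by
          rw [mem_map_ideal_iff 𝒜 J D a cu, hcu]
          exact Ideal.mem_map_of_mem _ huJ
        refine ⟨cu * cv, ?_, ?_⟩
        · rw [pow_succ']
          exact Ideal.mul_mem_mul hcuK hcvK
        · rw [map_mul, map_mul, hcu, hcv]
      | zero => exact ⟨0, Submodule.zero_mem _, by rw [map_zero, map_zero]⟩
      | add y z _ _ ihy ihz =>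
        obtain ⟨cy, hcyK, hcy⟩ := ihy
        obtain ⟨cz, hczK, hcz⟩ := ihz
        exact ⟨cy + cz, Submodule.add_mem _ hcyK hczK, by rw [map_add, map_add, hcy, hcz]⟩
      | neg y _ ihy =>
        obtain ⟨cy, hcyK, hcy⟩ := ihy
        exact ⟨-cy, Submodule.neg_mem _ hcyK, by rw [map_neg, map_neg, hcy]⟩
    obtain ⟨c, hcK, hc⟩ := hcl y hy
    refine ⟨c, hcK, ?_⟩
    -- `x` and `y` have the same image on `X`
    rw [Scheme.Hom.ker_apply, RingHom.mem_ker, map_sub, sub_eq_zero] at hxy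
    rw [hc]
    exact hxy.symm

end Chart

/-! ## Registered sub-goal -/

/-- **Sub-goal `stub_qs_atlasLift`** of the lead's `stub_qs_atlas` (registered on the crux item
for this file): the lifting of powers of the downstairs centre, `q♯(K(U a)^l) ⊆ i♯(J_{Dl}(W a) ∩ A₀)`
(`exists_lift_pow`). [folklore] -/
theorem stub_qs_atlasLift :
    ∀ {k : Type} [Field k] {Y X V : Scheme.{0}} {f : Y ⟶ Spec (.of k)} {i : X ⟶ Y}
      [IsClosedImmersion i] {q : X ⟶ V} [QuasiCompact q] {j : ℕ} (𝒜 : GradedAtlas j f i q)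
      (J : ℕ → Y.IdealSheafData) (D : ℕ) (a : 𝒜.ι), J 0 = ⊤ →
      (∀ m n : ℕ, J m * J n ≤ J (m + n)) →
      @Ideal.IsHomogeneous (Fin j → ℤ) (AddSubgroup Γ(Y, 𝒜.W a)) Γ(Y, 𝒜.W a) _ _ _ (𝒜.piece a)
        _ _ (𝒜.gradedRing a) ((J D).ideal (𝒜.W a)) →
      ∀ (l : ℕ) (c : Γ(V, 𝒜.U a)), c ∈ (((J D).comap i).map q).ideal (𝒜.U a) ^ l →
      ∃ x : Γ(Y, 𝒜.W a), x ∈ (J (D * l)).ideal (𝒜.W a) ∧ x ∈ 𝒜.piece a 0 ∧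
        i.app (𝒜.W a) x = q.appLE (𝒜.U a) (i ⁻¹ᵁ (𝒜.W a)) (𝒜.preimage_eq a).le c := by
  intro k _ Y X V f i _ q _ j 𝒜 J D a hJ0 hJmul hJ l c hc
  exact exists_lift_pow 𝒜 J D a hJ0 hJmul hJ l hc

end Summit.ResolutionOfSingularities.ResolutionOfSingularities.Theorems.DatumToEmbedded.Atlas

end
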